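import Summits.HodgeConjecture.HodgeConjecture.Theorems.Ring2HypothesesDescentMotivatedBoxBlocksHardLefschetz
import HarnessLib

/-!
# Ring 2 hypotheses, descent face — André's Lemme 1.3.2 on the real carriers, III: elimination and
# the Lemma (`*_{η₁} x ⊠ *_{η₂} y` is a combination of one-star sandwiches of `x ⊠ y`)

research route conditional on HC_CM; not a corollary; Q11.4-sentence-2 already refuted in dim ≥ 3.
Cell `pub-hodge-ring2` (Hodge ladder STAGE 3), seat `ring2-b05` (binder row b05
`Ring2.Hypotheses.MotivatedImpliesAlgebraicAV`), gen 35. `HC_CM` (`Theses.RankFourFaces.CMAbelianHodge`) does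
not occur in this file; nothing here proves a case of the Hodge conjecture.

Third file of the port of the tree's abstract `Motives/LefschetzStarExternalProduct` to `H•((V ⊗ W)(ℂ); ℂ)`
(André 1996 §1.3, Lemme 1.3.2, p. 13: «Il existe des nombres rationnels `r` tels que pour tous éléments
`x ∈ Hᵖ(X)`, `y ∈ H^q(Y)`, on ait `*_L x ⊗ *_L y = Σ r {L_X^• ⊗ L_Y^• ∘ *_{X×Y} ∘ (L_X^• x ⊗ L_Y^• y) …}`»). Here
`*` is André's Lefschetz involution `HodgeTheory.lefschetzInvolution` (the Lefschetz isomorphism below the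
middle degree, its inverse above), `θ = fst^* η₁ + snd^* η₂` the exterior sum on `V ⊗ W`, and the one-star
SANDWICHES of `x ⊠ y = fst^* x ∪ snd^* y` are the classes `𝓛₁ᵃ 𝓛₂ᵇ *_θ 𝓛₁ᶜ 𝓛₂ᵍ (x ⊠ y)`
(`𝓛₁ = fst^* η₁ ∪ ·`, `𝓛₂ = snd^* η₂ ∪ ·`, i.e. André's `L_X^• ⊗ L_Y^•`):

* §1 `lefschetzInvolution_lefschetzPowTo_eq` — **`*_η (Lʲ x) = Lˢ x` for `x ∈ Hⁱ`, `i + j + s = d`** (André §1.1: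
  `*_L (Lᵏ x_{j-2k}) = L^{d-j+k} x_{j-2k}`; for the sign-free `*_L` no primitivity is needed), and the Lefschetz
  decomposition of a class as a finite sum of `Lᵏ pₖ` over live indices (`sum_lefschetzPowTo_primitivePart`);
* §2 `mono_mem_starSpan` — **elimination**: every monomial `L₁ᵃ pₖ ⊠ L₂ᵇ qₗ` of every block of the Lefschetz
  bi-decomposition of `(x, y)` lies in the span of the sandwiches of `x ⊠ y` (descending induction over the pairs
  `(k, l)`: `𝓛₁ᶜ 𝓛₂ᵍ (x ⊠ y)` is the top monomial of the block of `(pₖ, qₗ)` plus monomials of higher blocks, the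
  lower ones die; `*_θ` of the top is `c₀ • (pₖ ⊠ qₗ)` with `c₀ ≠ 0`, `lefschetzInvolution_boxSum_topMono`; the
  other blocks are `*_θ`-stable, `lefschetzInvolution_boxSum_mem_block`);
* §3 `cross_lefschetzInvolution_mem_sandwichSpan` — **Lemme 1.3.2**: `*_{η₁} x ⊠ *_{η₂} y` lies in the
  `ℂ`-span of the sandwiches of `x ⊠ y`, for ALL `x ∈ H^{j₁}(V(ℂ))`, `y ∈ H^{j₂}(W(ℂ))`.

No definition, no named fact, no sorry. References: Andre1996Motifs (§1.1 p. 10, §1.3 Lemme 1.3.2 p. 13, proof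
of Prop. 2.1 p. 15), Kleiman1968AlgebraicCycles (§1.4), VoisinHodgeI2002 (§6.2.3 Cor. 6.26).
-/

noncomputable section

-- every declaration of this problem lives in `Summit.HodgeConjecture.HodgeConjecture.…` (summit = sub-problem)
set_option linter.dupNamespace false

open CategoryTheory AlgebraicGeometry MonoidalCategory CartesianMonoidalCategory
open Literature.AlgebraicTopology.SingularHomology Literature.Geometry.Kaehler
open Literature.AlgebraicGeometry Literature.AlgebraicGeometry.Motives
  Literature.AlgebraicGeometry.HodgeTheory

namespace Summit.HodgeConjecture.HodgeConjecture.Theorems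

/-! ## §1 `*_η (Lʲ x) = Lˢ x` and the Lefschetz decomposition as a finite sum -/

/-- **André's `*_L` on an iterated Lefschetz class: `*_η (Lʲ x) = Lˢ x` for `x ∈ Hⁱ`, `i + j + s = d`** (for
`η` with the hard Lefschetz property in dimension `d`; André §1.1: «`*_L (Lᵏ x_{j-2k}) = L^{d-j+k} x_{j-2k}`»). No
primitivity is needed for the sign-free involution: below the middle degree `*_η = L^{d - i - 2j}`, above it
`Lʲ x = L^{j-s} (Lˢ x)` and `*_η` undoes `L^{j-s}`. [cite: Andre1996Motifs, §1.1 (p. 10)] -/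
theorem lefschetzInvolution_lefschetzPowTo_eq {Y : SchemeOver ℂ} {η : complexBetti Y 2} {d : ℕ}
    (hL : HasHardLefschetzProperty η d) {i j s m m' : ℕ} (hijs : i + j + s = d) (hm : i + 2 * j = m)
    (hmm' : m + m' = 2 * d) (hm' : i + 2 * s = m') (x : complexBetti Y i) :
    lefschetzInvolution hL hmm' (lefschetzPowTo η j i m hm x) = lefschetzPowTo η s i m' hm' x := by
  by_cases hle : m ≤ d
  · obtain ⟨u, hu⟩ : ∃ u, m + u = d := ⟨d - m, by omega⟩
    obtain rfl : m' = m + 2 * u := by omega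
    rw [lefschetzInvolution_apply_of_le hL hu hmm', ← lefschetzPowTo_eq_lefschetzPow,
      lefschetzPowTo_comp_apply η (show j + u = s by omega) hm rfl hm']
  · obtain ⟨u, hu⟩ : ∃ u, m' + u = d := ⟨d - m', by omega⟩
    obtain rfl : m = m' + 2 * u := by omega
    rw [← lefschetzPowTo_comp_apply η (show s + u = j by omega) hm' rfl hm, lefschetzPowTo_eq_lefschetzPow,
      lefschetzInvolution_lefschetzPow hL hu hmm']

/-- **Lefschetz decomposition, finite-sum form** (Voisin I Cor. 6.26; André §1.1 «`x = Σ Lᵏ x_{j-2k}` est la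
décomposition de Lefschetz de `x ∈ Hʲ(X)`»): for `X` smooth projective of dimension `n` and `η` with the hard
Lefschetz property, every `x ∈ Hʲ(X(ℂ); ℂ)` is a finite sum `Σ Lᵏ pᵢₖ` of Lefschetz iterates of PRIMITIVE classes
`pᵢₖ ∈ Pⁱ`, `i + 2k = j`, over live indices `i + k ≤ n` (the primitive parts `ξ_{(i,k)} x`, which vanish for
`i + k > n`). [cite: VoisinHodgeI2002, §6.2.3 Cor. 6.26] [cite: Andre1996Motifs, §1.1 (p. 10)] -/
theorem exists_sum_lefschetzPowTo_eq {n : ℕ} {X : SchemeOver ℂ} (hX : IsSmoothProjective n X)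
    {η : complexBetti X 2} (hη : HasHardLefschetzProperty η n) {j : ℕ} (x : complexBetti X j) :
    ∃ (s : Finset {ik : ℕ × ℕ // ik.1 + 2 * ik.2 = j})
      (p : (ik : {ik : ℕ × ℕ // ik.1 + 2 * ik.2 = j}) → complexBetti X ik.1.1),
      (∀ ik, p ik ∈ primitiveClasses η n ik.1.1) ∧ (∀ ik ∈ s, ik.1.1 + ik.1.2 ≤ n) ∧
        x = ∑ ik ∈ s, lefschetzPowTo η ik.1.2 ik.1.1 j ik.2 (p ik) := by
  classical
  have hvan : ∀ m, 2 * n < m → Subsingleton (complexBetti X m) := fun m hm ↦ subsingleton_complexBetti hX hm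
  refine ⟨Finset.univ.filter (fun ik ↦ ik.1.1 + ik.1.2 ≤ n), fun ik ↦ primitivePart η n hη hvan ik x,
    fun ik ↦ primitivePart_mem hη hvan ik x, fun ik hik ↦ (Finset.mem_filter.1 hik).2, ?_⟩
  rw [Finset.sum_filter]
  conv_lhs => rw [← sum_lefschetzPowTo_primitivePart hη hvan x]
  refine Finset.sum_congr rfl fun ik _ ↦ ?_
  split_ifs with h
  · rfl
  · rw [primitivePart_of_lt hη hvan ik (not_le.1 h), LinearMap.zero_apply, map_zero]

/-! ## §2 Elimination -/

variable {d₁ d₂ : ℕ} {V W : SchemeOver ℂ} {η₁ : complexBetti V 2} {η₂ : complexBetti W 2}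

/-- **Elimination** (the heart of Lemme 1.3.2, André §1.3): let `x = Σₖ L₁ᵏ pₖ ∈ H^{j₁}(V(ℂ))`,
`y = Σₗ L₂ˡ qₗ ∈ H^{j₂}(W(ℂ))` be Lefschetz decompositions (finite sums over live indices, `pₖ`, `qₗ` primitive)
and `θ = fst^* η₁ + snd^* η₂` (hard Lefschetz on the `(d₁+d₂)`-fold `V ⊗ W`). Then EVERY monomial
`L₁ᵃ pₖ ⊠ L₂ᵇ qₗ` of every block lies in the `ℂ`-span of the sandwiches `𝓛₁ᵃ' 𝓛₂ᵇ' *_θ 𝓛₁ᶜ 𝓛₂ᵍ (x ⊠ y)`.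
Descending induction over the pairs `(k, l)`: with `iₖ + k + c = d₁`, `i'ₗ + l + g = d₂`, the class
`𝓛₁ᶜ 𝓛₂ᵍ (x ⊠ y)` is the top monomial of the block of `(pₖ, qₗ)` plus monomials of the blocks of the pairs
`(k', l') > (k, l)` (those with `k' < k` or `l' < l` die past the tops of their strings), `*_θ` of the top is
`c₀ • (pₖ ⊠ qₗ)` with `c₀ ≠ 0` (`lefschetzInvolution_boxSum_topMono`), `*_θ` and `𝓛₁ᵃ 𝓛₂ᵇ` preserve the other
blocks (`lefschetzInvolution_boxSum_mem_block`), which lie in the span by induction.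
[cite: Andre1996Motifs, §1.3 proof of Lemme 1.3.2 (p. 13)] -/
theorem mono_mem_starSpan (hV : IsSmoothProjective d₁ V) (hW : IsSmoothProjective d₂ W)
    (hη₁ : HasHardLefschetzProperty η₁ d₁) (hη₂ : HasHardLefschetzProperty η₂ d₂)
    (hθ : HasHardLefschetzProperty (complexBetti.map (fst V W) 2 η₁ + complexBetti.map (snd V W) 2 η₂) (d₁ + d₂))
    {j₁ j₂ : ℕ} {x : complexBetti V j₁} {y : complexBetti W j₂}
    (sx : Finset {ik : ℕ × ℕ // ik.1 + 2 * ik.2 = j₁})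
    (px : (ik : {ik : ℕ × ℕ // ik.1 + 2 * ik.2 = j₁}) → complexBetti V ik.1.1)
    (hpx : ∀ ik, px ik ∈ primitiveClasses η₁ d₁ ik.1.1) (hsx : ∀ ik ∈ sx, ik.1.1 + ik.1.2 ≤ d₁)
    (hx : x = ∑ ik ∈ sx, lefschetzPowTo η₁ ik.1.2 ik.1.1 j₁ ik.2 (px ik))
    (sy : Finset {il : ℕ × ℕ // il.1 + 2 * il.2 = j₂})
    (qy : (il : {il : ℕ × ℕ // il.1 + 2 * il.2 = j₂}) → complexBetti W il.1.1)
    (hqy : ∀ il, qy il ∈ primitiveClasses η₂ d₂ il.1.1) (hsy : ∀ il ∈ sy, il.1.1 + il.1.2 ≤ d₂)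
    (hy : y = ∑ il ∈ sy, lefschetzPowTo η₂ il.1.2 il.1.1 j₂ il.2 (qy il))
    {ik : {ik : ℕ × ℕ // ik.1 + 2 * ik.2 = j₁}} (hik : ik ∈ sx)
    {il : {il : ℕ × ℕ // il.1 + 2 * il.2 = j₂}} (hil : il ∈ sy) (a' b' : ℕ) {T : ℕ}
    (hT : ik.1.1 + 2 * a' + (il.1.1 + 2 * b') = T) :
    cupProduct hT (complexBetti.map (fst V W) (ik.1.1 + 2 * a')
          (lefschetzPowTo η₁ a' ik.1.1 (ik.1.1 + 2 * a') rfl (px ik)))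
        (complexBetti.map (snd V W) (il.1.1 + 2 * b') (lefschetzPowTo η₂ b' il.1.1 (il.1.1 + 2 * b') rfl (qy il))) ∈
      Submodule.span ℂ {z : complexBetti (V ⊗ W) T | ∃ (a b c g N₁ M M' N₂ : ℕ) (hg : j₁ + j₂ + 2 * g = N₁)
        (hc : N₁ + 2 * c = M) (hMM' : M + M' = 2 * (d₁ + d₂)) (hb : M' + 2 * b = N₂) (ha : N₂ + 2 * a = T),
        z = lefschetzPowTo (complexBetti.map (fst V W) 2 η₁) a N₂ T ha
          (lefschetzPowTo (complexBetti.map (snd V W) 2 η₂) b M' N₂ hb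
            (lefschetzInvolution hθ hMM'
              (lefschetzPowTo (complexBetti.map (fst V W) 2 η₁) c N₁ M hc
                (lefschetzPowTo (complexBetti.map (snd V W) 2 η₂) g (j₁ + j₂) N₁ hg
                  (cupProduct rfl (complexBetti.map (fst V W) j₁ x) (complexBetti.map (snd V W) j₂ y))))))} := by
  classical
  -- the double-sum expansion of `x ⊠ y` in monomials
  have hxy : cupProduct rfl (complexBetti.map (fst V W) j₁ x) (complexBetti.map (snd V W) j₂ y) =
      ∑ ik ∈ sx, ∑ il ∈ sy, cupProduct (by have := ik.2; have := il.2; omega)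
        (complexBetti.map (fst V W) (ik.1.1 + 2 * ik.1.2)
          (lefschetzPowTo η₁ ik.1.2 ik.1.1 (ik.1.1 + 2 * ik.1.2) rfl (px ik)))
        (complexBetti.map (snd V W) (il.1.1 + 2 * il.1.2)
          (lefschetzPowTo η₂ il.1.2 il.1.1 (il.1.1 + 2 * il.1.2) rfl (qy il))) := by
    rw [hx, hy]
    simp only [map_sum, LinearMap.sum_apply]
    -- `simp` distributes the second factor first: swap the two sums back
    exact Finset.sum_comm.trans
      (Finset.sum_congr rfl fun ik _ ↦ Finset.sum_congr rfl fun il _ ↦ mono_congr ik.1.2 il.1.2 ik.2 il.2 rfl _)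
  -- descending induction over the pairs, measured by `e = j₁ + j₂ - (k + l)`
  suffices key : ∀ (e : ℕ) (ik : {ik : ℕ × ℕ // ik.1 + 2 * ik.2 = j₁}), ik ∈ sx →
      ∀ (il : {il : ℕ × ℕ // il.1 + 2 * il.2 = j₂}), il ∈ sy → ik.1.2 + il.1.2 + e = j₁ + j₂ →
      ∀ (a' b' : ℕ) (T : ℕ) (hT : ik.1.1 + 2 * a' + (il.1.1 + 2 * b') = T),
      cupProduct hT (complexBetti.map (fst V W) (ik.1.1 + 2 * a')
            (lefschetzPowTo η₁ a' ik.1.1 (ik.1.1 + 2 * a') rfl (px ik)))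
          (complexBetti.map (snd V W) (il.1.1 + 2 * b')
            (lefschetzPowTo η₂ b' il.1.1 (il.1.1 + 2 * b') rfl (qy il))) ∈
        Submodule.span ℂ {z : complexBetti (V ⊗ W) T | ∃ (a b c g N₁ M M' N₂ : ℕ) (hg : j₁ + j₂ + 2 * g = N₁)
          (hc : N₁ + 2 * c = M) (hMM' : M + M' = 2 * (d₁ + d₂)) (hb : M' + 2 * b = N₂) (ha : N₂ + 2 * a = T),
          z = lefschetzPowTo (complexBetti.map (fst V W) 2 η₁) a N₂ T ha
            (lefschetzPowTo (complexBetti.map (snd V W) 2 η₂) b M' N₂ hb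
              (lefschetzInvolution hθ hMM'
                (lefschetzPowTo (complexBetti.map (fst V W) 2 η₁) c N₁ M hc
                  (lefschetzPowTo (complexBetti.map (snd V W) 2 η₂) g (j₁ + j₂) N₁ hg
                    (cupProduct rfl (complexBetti.map (fst V W) j₁ x) (complexBetti.map (snd V W) j₂ y))))))} by
    have h1 := ik.2
    have h2 := il.2
    exact key (j₁ + j₂ - (ik.1.2 + il.1.2)) ik hik il hil (by omega) a' b' T hT
  intro e
  refine Nat.strong_induction_on e fun e IH ↦ ?_
  intro ik hik il hil he a' b' T hT
  -- exponents sending the components `ik`, `il` to the tops of their strings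
  obtain ⟨c, hc⟩ : ∃ c, ik.1.1 + ik.1.2 + c = d₁ := ⟨d₁ - (ik.1.1 + ik.1.2), by have := hsx ik hik; omega⟩
  obtain ⟨g, hg⟩ : ∃ g, il.1.1 + il.1.2 + g = d₂ := ⟨d₂ - (il.1.1 + il.1.2), by have := hsy il hil; omega⟩
  have eik := ik.2
  have eil := il.2
  -- the degrees of the sandwich attached to `(a', b', c, g)`
  set N₁ := j₁ + j₂ + 2 * g with hN₁def
  set M := N₁ + 2 * c with hMdef
  have hMM' : M + (ik.1.1 + il.1.1) = 2 * (d₁ + d₂) := by omega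
  have hT' : ik.1.1 + il.1.1 + 2 * b' + 2 * a' = T := by omega
  -- the expansion of `𝓛₁ᶜ 𝓛₂ᵍ (x ⊠ y)` in monomials
  have hcup : lefschetzPowTo (complexBetti.map (fst V W) 2 η₁) c N₁ M rfl
      (lefschetzPowTo (complexBetti.map (snd V W) 2 η₂) g (j₁ + j₂) N₁ rfl
        (cupProduct rfl (complexBetti.map (fst V W) j₁ x) (complexBetti.map (snd V W) j₂ y))) =
      ∑ kl ∈ sx ×ˢ sy, cupProduct (by have := kl.1.2; have := kl.2.2; omega)
        (complexBetti.map (fst V W) (kl.1.1.1 + 2 * (kl.1.1.2 + c))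
          (lefschetzPowTo η₁ (kl.1.1.2 + c) kl.1.1.1 (kl.1.1.1 + 2 * (kl.1.1.2 + c)) rfl (px kl.1)))
        (complexBetti.map (snd V W) (kl.2.1.1 + 2 * (kl.2.1.2 + g))
          (lefschetzPowTo η₂ (kl.2.1.2 + g) kl.2.1.1 (kl.2.1.1 + 2 * (kl.2.1.2 + g)) rfl (qy kl.2))) := by
    rw [hxy, map_sum, map_sum, Finset.sum_product]
    refine Finset.sum_congr rfl fun ik' _ ↦ ?_
    rw [map_sum, map_sum]
    refine Finset.sum_congr rfl fun il' _ ↦ ?_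
    have e1 := ik'.2
    have e2 := il'.2
    rw [lefschetzPowTo_snd_pow_mono g ik'.1.2 il'.1.2 rfl _ N₁ _ rfl (by omega),
      lefschetzPowTo_fst_pow_mono c ik'.1.2 (il'.1.2 + g) rfl N₁ M _ rfl (by omega)]
  -- isolate the pair `(ik, il)`: its term is the top monomial of the block of `(pₖ, qₗ)`
  have hmem : (ik, il) ∈ sx ×ˢ sy := Finset.mem_product.2 ⟨hik, hil⟩
  rw [← Finset.add_sum_erase _ _ hmem] at hcup
  dsimp only at hcup
  -- `*_θ` of the top monomial
  obtain ⟨c₀, hc₀, hstar⟩ := lefschetzInvolution_boxSum_topMono (η₁ := η₁) (η₂ := η₂) hV hW hθ (hpx ik) (hqy il)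
    (m₁ := ik.1.2 + c) (m₂ := il.1.2 + g) (by omega) (by omega) (N := M) (by omega) hMM'
  -- the sandwich attached to `(a', b', c, g)` lies in the span
  have hgen : lefschetzPowTo (complexBetti.map (fst V W) 2 η₁) a' (ik.1.1 + il.1.1 + 2 * b') T hT'
      (lefschetzPowTo (complexBetti.map (snd V W) 2 η₂) b' (ik.1.1 + il.1.1) (ik.1.1 + il.1.1 + 2 * b') rfl
        (lefschetzInvolution hθ hMM'
          (lefschetzPowTo (complexBetti.map (fst V W) 2 η₁) c N₁ M rfl
            (lefschetzPowTo (complexBetti.map (snd V W) 2 η₂) g (j₁ + j₂) N₁ rfl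
              (cupProduct rfl (complexBetti.map (fst V W) j₁ x) (complexBetti.map (snd V W) j₂ y)))))) ∈
      Submodule.span ℂ {z : complexBetti (V ⊗ W) T | ∃ (a b c g N₁ M M' N₂ : ℕ) (hg : j₁ + j₂ + 2 * g = N₁)
          (hc : N₁ + 2 * c = M) (hMM' : M + M' = 2 * (d₁ + d₂)) (hb : M' + 2 * b = N₂) (ha : N₂ + 2 * a = T),
          z = lefschetzPowTo (complexBetti.map (fst V W) 2 η₁) a N₂ T ha
            (lefschetzPowTo (complexBetti.map (snd V W) 2 η₂) b M' N₂ hb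
              (lefschetzInvolution hθ hMM'
                (lefschetzPowTo (complexBetti.map (fst V W) 2 η₁) c N₁ M hc
                  (lefschetzPowTo (complexBetti.map (snd V W) 2 η₂) g (j₁ + j₂) N₁ hg
                    (cupProduct rfl (complexBetti.map (fst V W) j₁ x) (complexBetti.map (snd V W) j₂ y))))))} :=
    Submodule.subset_span ⟨a', b', c, g, N₁, M, _, _, rfl, rfl, hMM', rfl, hT', rfl⟩
  -- rewrite it as `c₀ • (target monomial) + (sandwiched rest)`
  have htarget : lefschetzPowTo (complexBetti.map (fst V W) 2 η₁) a' (ik.1.1 + il.1.1 + 2 * b') T hT'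
      (lefschetzPowTo (complexBetti.map (snd V W) 2 η₂) b' (ik.1.1 + il.1.1) (ik.1.1 + il.1.1 + 2 * b') rfl
        (cupProduct rfl (complexBetti.map (fst V W) ik.1.1 (px ik)) (complexBetti.map (snd V W) il.1.1 (qy il)))) =
      cupProduct hT (complexBetti.map (fst V W) (ik.1.1 + 2 * a')
          (lefschetzPowTo η₁ a' ik.1.1 (ik.1.1 + 2 * a') rfl (px ik)))
        (complexBetti.map (snd V W) (il.1.1 + 2 * b')
          (lefschetzPowTo η₂ b' il.1.1 (il.1.1 + 2 * b') rfl (qy il))) := by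
    rw [← mono_zero_zero (η₁ := η₁) (η₂ := η₂) (p := px ik) (q := qy il) (by omega) rfl,
      lefschetzPowTo_snd_pow_mono b' 0 0 (by omega : 0 + b' = b') _ _ _ rfl (by omega),
      lefschetzPowTo_fst_pow_mono a' 0 b' (by omega : 0 + a' = a') _ T _ hT' hT]
  rw [hcup, map_add, map_add, map_add, hstar, map_smul, map_smul, htarget, map_sum, map_sum, map_sum] at hgen
  -- the remaining terms lie in the span, by induction
  have hrest : ∑ kl ∈ (sx ×ˢ sy).erase (ik, il),
      lefschetzPowTo (complexBetti.map (fst V W) 2 η₁) a' (ik.1.1 + il.1.1 + 2 * b') T hT'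
        (lefschetzPowTo (complexBetti.map (snd V W) 2 η₂) b' (ik.1.1 + il.1.1) (ik.1.1 + il.1.1 + 2 * b') rfl
          (lefschetzInvolution hθ hMM'
            (cupProduct (by have := kl.1.2; have := kl.2.2; omega)
              (complexBetti.map (fst V W) (kl.1.1.1 + 2 * (kl.1.1.2 + c))
                (lefschetzPowTo η₁ (kl.1.1.2 + c) kl.1.1.1 (kl.1.1.1 + 2 * (kl.1.1.2 + c)) rfl (px kl.1)))
              (complexBetti.map (snd V W) (kl.2.1.1 + 2 * (kl.2.1.2 + g))
                (lefschetzPowTo η₂ (kl.2.1.2 + g) kl.2.1.1 (kl.2.1.1 + 2 * (kl.2.1.2 + g)) rfl (qy kl.2)))))) ∈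
      Submodule.span ℂ {z : complexBetti (V ⊗ W) T | ∃ (a b c g N₁ M M' N₂ : ℕ) (hg : j₁ + j₂ + 2 * g = N₁)
          (hc : N₁ + 2 * c = M) (hMM' : M + M' = 2 * (d₁ + d₂)) (hb : M' + 2 * b = N₂) (ha : N₂ + 2 * a = T),
          z = lefschetzPowTo (complexBetti.map (fst V W) 2 η₁) a N₂ T ha
            (lefschetzPowTo (complexBetti.map (snd V W) 2 η₂) b M' N₂ hb
              (lefschetzInvolution hθ hMM'
                (lefschetzPowTo (complexBetti.map (fst V W) 2 η₁) c N₁ M hc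
                  (lefschetzPowTo (complexBetti.map (snd V W) 2 η₂) g (j₁ + j₂) N₁ hg
                    (cupProduct rfl (complexBetti.map (fst V W) j₁ x) (complexBetti.map (snd V W) j₂ y))))))} := by
    refine Submodule.sum_mem _ fun kl hkl ↦ ?_
    obtain ⟨hne, hkl'⟩ := Finset.mem_erase.1 hkl
    obtain ⟨hk1, hk2⟩ := Finset.mem_product.1 hkl'
    have e1 := kl.1.2
    have e2 := kl.2.2
    -- the pairs with `k' < k` or `l' < l` die
    by_cases hlt₁ : kl.1.1.2 < ik.1.2
    · rw [mono_eq_zero_left (hpx kl.1) _ (by omega), map_zero, map_zero, map_zero]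
      exact zero_mem _
    by_cases hlt₂ : kl.2.1.2 < il.1.2
    · rw [mono_eq_zero_right (hqy kl.2) _ (by omega), map_zero, map_zero, map_zero]
      exact zero_mem _
    -- the others are higher pairs: their whole block lies in the span by induction
    have hgt : ik.1.2 + il.1.2 < kl.1.1.2 + kl.2.1.2 := by
      by_contra hle
      apply hne
      have hk : kl.1.1.2 = ik.1.2 := by omega
      have hl : kl.2.1.2 = il.1.2 := by omega
      have hk' : kl.1.1.1 = ik.1.1 := by omega
      have hl' : kl.2.1.1 = il.1.1 := by omega
      exact Prod.ext (Subtype.ext (Prod.ext hk' hk)) (Subtype.ext (Prod.ext hl' hl))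
    have hblock : Submodule.span ℂ {z : complexBetti (V ⊗ W) T | ∃ (s t : ℕ)
        (h : kl.1.1.1 + 2 * s + (kl.2.1.1 + 2 * t) = T),
        z = cupProduct h (complexBetti.map (fst V W) (kl.1.1.1 + 2 * s)
            (lefschetzPowTo η₁ s kl.1.1.1 (kl.1.1.1 + 2 * s) rfl (px kl.1)))
          (complexBetti.map (snd V W) (kl.2.1.1 + 2 * t)
            (lefschetzPowTo η₂ t kl.2.1.1 (kl.2.1.1 + 2 * t) rfl (qy kl.2)))} ≤
        Submodule.span ℂ {z : complexBetti (V ⊗ W) T | ∃ (a b c g N₁ M M' N₂ : ℕ) (hg : j₁ + j₂ + 2 * g = N₁)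
          (hc : N₁ + 2 * c = M) (hMM' : M + M' = 2 * (d₁ + d₂)) (hb : M' + 2 * b = N₂) (ha : N₂ + 2 * a = T),
          z = lefschetzPowTo (complexBetti.map (fst V W) 2 η₁) a N₂ T ha
            (lefschetzPowTo (complexBetti.map (snd V W) 2 η₂) b M' N₂ hb
              (lefschetzInvolution hθ hMM'
                (lefschetzPowTo (complexBetti.map (fst V W) 2 η₁) c N₁ M hc
                  (lefschetzPowTo (complexBetti.map (snd V W) 2 η₂) g (j₁ + j₂) N₁ hg
                    (cupProduct rfl (complexBetti.map (fst V W) j₁ x) (complexBetti.map (snd V W) j₂ y))))))} := by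
      refine Submodule.span_le.2 ?_
      rintro _ ⟨s', t', h', rfl⟩
      exact IH (j₁ + j₂ - (kl.1.1.2 + kl.2.1.2)) (by omega) kl.1 hk1 kl.2 hk2 (by omega) s' t' T h'
    refine hblock (lefschetzPowTo_fst_pow_mem_block a' hT' (lefschetzPowTo_snd_pow_mem_block b' rfl ?_))
    exact lefschetzInvolution_boxSum_mem_block hV hW hη₁ hη₂ hθ (hpx kl.1) (hqy kl.2) hMM'
      (mono_mem_block η₁ η₂ _ _ _ _ _ _)
  -- conclusion: `mono = c₀⁻¹ • (sandwich - rest)`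
  have hfinal := Submodule.smul_mem _ c₀⁻¹ (Submodule.sub_mem _ hgen hrest)
  rwa [add_sub_cancel_right, smul_smul, inv_mul_cancel₀ hc₀, one_smul] at hfinal

/-! ## §3 Lemme 1.3.2 -/

/-- **André's Lemme 1.3.2 on the real carriers** (qualitative form). Let `V`, `W` be smooth projective complex
varieties of dimensions `d₁`, `d₂`, `η₁ ∈ H²(V(ℂ); ℂ)`, `η₂ ∈ H²(W(ℂ); ℂ)` classes with the hard Lefschetz
property, `*_{η₁}`, `*_{η₂}` their Lefschetz involutions (André's `*_L`, `HodgeTheory.lefschetzInvolution`),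
`θ = fst^* η₁ + snd^* η₂` the exterior sum (hard Lefschetz on the `(d₁+d₂)`-fold `V ⊗ W`,
`hasHardLefschetzProperty_boxSum`) and `*_θ` its involution. Then for ALL `x ∈ H^{j₁}(V(ℂ))`, `y ∈ H^{j₂}(W(ℂ))`
the cross product `*_{η₁} x ⊠ *_{η₂} y = fst^*(*_{η₁} x) ∪ snd^*(*_{η₂} y)` lies in the `ℂ`-span of the ONE-STAR
sandwiches `𝓛₁ᵃ 𝓛₂ᵇ *_θ 𝓛₁ᶜ 𝓛₂ᵍ (x ⊠ y)` (`𝓛₁ = fst^* η₁ ∪ ·`, `𝓛₂ = snd^* η₂ ∪ ·`) — André: «Il existe des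
nombres rationnels `r` tels que pour tous `x ∈ Hᵖ(X)`, `y ∈ H^q(Y)`, on ait
`*_L x ⊗ *_L y = Σ r {(L_X^• ⊗ L_Y^•) ∘ *_{X×Y} ∘ (L_X^• x ⊗ L_Y^• y) …}`». Proof: Lefschetz-decompose `x` and `y`
(`exists_sum_lefschetzPowTo_eq`); then `*_{η₁} x ⊠ *_{η₂} y = Σ L₁^• pₖ ⊠ L₂^• qₗ`
(`lefschetzInvolution_lefschetzPowTo_eq`) is a combination of monomials, each in the span by the elimination
`mono_mem_starSpan`. [cite: Andre1996Motifs, §1.3 Lemme 1.3.2 (p. 13)] -/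
theorem cross_lefschetzInvolution_mem_sandwichSpan (hV : IsSmoothProjective d₁ V) (hW : IsSmoothProjective d₂ W)
    (hη₁ : HasHardLefschetzProperty η₁ d₁) (hη₂ : HasHardLefschetzProperty η₂ d₂)
    (hθ : HasHardLefschetzProperty (complexBetti.map (fst V W) 2 η₁ + complexBetti.map (snd V W) 2 η₂) (d₁ + d₂))
    {j₁ j₁' j₂ j₂' T : ℕ} (h₁ : j₁ + j₁' = 2 * d₁) (h₂ : j₂ + j₂' = 2 * d₂) (hT : j₁' + j₂' = T)
    (x : complexBetti V j₁) (y : complexBetti W j₂) :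
    cupProduct hT (complexBetti.map (fst V W) j₁' (lefschetzInvolution hη₁ h₁ x))
        (complexBetti.map (snd V W) j₂' (lefschetzInvolution hη₂ h₂ y)) ∈
      Submodule.span ℂ {z : complexBetti (V ⊗ W) T | ∃ (a b c g N₁ M M' N₂ : ℕ) (hg : j₁ + j₂ + 2 * g = N₁)
        (hc : N₁ + 2 * c = M) (hMM' : M + M' = 2 * (d₁ + d₂)) (hb : M' + 2 * b = N₂) (ha : N₂ + 2 * a = T),
        z = lefschetzPowTo (complexBetti.map (fst V W) 2 η₁) a N₂ T ha
          (lefschetzPowTo (complexBetti.map (snd V W) 2 η₂) b M' N₂ hb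
            (lefschetzInvolution hθ hMM'
              (lefschetzPowTo (complexBetti.map (fst V W) 2 η₁) c N₁ M hc
                (lefschetzPowTo (complexBetti.map (snd V W) 2 η₂) g (j₁ + j₂) N₁ hg
                  (cupProduct rfl (complexBetti.map (fst V W) j₁ x) (complexBetti.map (snd V W) j₂ y))))))} := by
  classical
  -- Lefschetz decompositions of `x` and `y`
  obtain ⟨sx, px, hpx, hsx, hx⟩ := exists_sum_lefschetzPowTo_eq hV hη₁ x
  obtain ⟨sy, qy, hqy, hsy, hy⟩ := exists_sum_lefschetzPowTo_eq hW hη₂ y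
  -- `*_{η₁} x ⊠ *_{η₂} y` as a double sum of monomials
  have hsum : cupProduct hT (complexBetti.map (fst V W) j₁' (lefschetzInvolution hη₁ h₁ x))
      (complexBetti.map (snd V W) j₂' (lefschetzInvolution hη₂ h₂ y)) = ∑ ik ∈ sx, ∑ il ∈ sy,
      cupProduct hT (complexBetti.map (fst V W) j₁'
          (lefschetzInvolution hη₁ h₁ (lefschetzPowTo η₁ ik.1.2 ik.1.1 j₁ ik.2 (px ik))))
        (complexBetti.map (snd V W) j₂'
          (lefschetzInvolution hη₂ h₂ (lefschetzPowTo η₂ il.1.2 il.1.1 j₂ il.2 (qy il)))) := by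
    rw [hx, hy]
    simp only [map_sum, LinearMap.sum_apply]
    exact Finset.sum_comm
  rw [hsum]
  refine Submodule.sum_mem _ fun ik hik ↦ Submodule.sum_mem _ fun il hil ↦ ?_
  have e1 := ik.2
  have e2 := il.2
  obtain ⟨s₁, hs₁⟩ : ∃ s₁, ik.1.1 + ik.1.2 + s₁ = d₁ := ⟨d₁ - (ik.1.1 + ik.1.2), by have := hsx ik hik; omega⟩
  obtain ⟨s₂, hs₂⟩ : ∃ s₂, il.1.1 + il.1.2 + s₂ = d₂ := ⟨d₂ - (il.1.1 + il.1.2), by have := hsy il hil; omega⟩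
  rw [lefschetzInvolution_lefschetzPowTo_eq hη₁ hs₁ ik.2 h₁ (show ik.1.1 + 2 * s₁ = j₁' by omega),
    lefschetzInvolution_lefschetzPowTo_eq hη₂ hs₂ il.2 h₂ (show il.1.1 + 2 * s₂ = j₂' by omega),
    mono_congr s₁ s₂ _ _ hT (by omega)]
  exact mono_mem_starSpan hV hW hη₁ hη₂ hθ sx px hpx hsx hx sy qy hqy hsy hy hik hil s₁ s₂ _

end Summit.HodgeConjecture.HodgeConjecture.Theorems

end
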